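import Literature.AlgebraicGeometry.HodgeTheory.HypersurfaceFamilyRelativeResidueForms
import Literature.AlgebraicGeometry.HodgeTheory.TopFormFrameOfResidues
import HarnessLib

/-!
# The relative residue forms of a family of smooth hypersurfaces restrict to a frame of `FⁿHⁿ` on every
# nearby fibre

Family `hodge`, layer `Literature/AlgebraicGeometry/HodgeTheory`. Theorems only; no definition, no named
fact. Written by the prover seat `hodge-nonav-prover-Ax` (g12, cell `hodge-nonav`) as the fibrewise-frame
half of brick FF4 of the programme «GRIFFITHS-SURFACES / B4 RELATIVE RESIDUES» (route
`HodgeConjecture/CyclicUnitaryPowers`); the frame assembly proper (`HodgeFrameOfRelativeForms`, prover-Bx)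
consumes exactly the package `exists_residueFrame_familySpz` proved here.

* `residueFrame_of_hypersurfacePoint_basis` — the Fⁿ-frame of a smooth hypersurface `X ≅ V(F) ⊂ ℙⁿ⁺¹`
  by Griffiths residues `Res(P_j Ω/F)` for a GIVEN basis `(P_j)` of `S^{d−n−2}` (the frame theorem
  `residueFrame_of_hypersurfacePoint` of `TopFormFrameOfResidues` with the basis exposed, so that one
  basis serves all fibres of a family): the classes `Θ_B⁻¹((∫⊗ℂ)[ψ_B^* Res(P_jΩ/F)])` on the algebraic-chart
  model `B` are linearly independent and span `FⁿHⁿ(X)` of every Hodge-symmetric model (Voisin II §6.1.3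
  Cor. 6.12 at pole order one; Voisin I Cor. 7.6).
* `exists_residueFrame_familySpz` — for the family `f = familySpz ℂ n d sp : 𝒴_sp ⟶ S_sp`, `n = n₀ + 1`,
  `d ≥ n + 2`, base smooth of relative dimension `m`, and `t₁ ∈ S_sp(ℂ)`: an open `O ∋ t₁` and finitely
  many SMOOTH `n`-forms `Ξ_j` on `𝒴_sp(ℂ)` (the glued relative residue forms of a basis of `S^{d−n−2}`,
  `HypersurfaceFamilyRelativeResidueForms`) with the vertical `(1,0)`-condition over `O`, whose pull-backs
  to every fibre `X_b(ℂ)`, `b ∈ O`, are closed forms whose de Rham classes, read back on the rational side,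
  form a frame of `FⁿHⁿ(X_b)` — the hypotheses `hΞ`/`hdΞ`/`hframe` of the frame assembly.

HONEST FRAMING: nothing here says HC is proved.

## References

* [VoisinHodgeII2003] C. Voisin, Hodge Theory and Complex Algebraic Geometry II (2003), §6.1.3 Cor. 6.12,
  §6.2.1.
* [VoisinHodgeI2002] C. Voisin, Hodge Theory and Complex Algebraic Geometry I (2002), §7.1.1 Cor. 7.6,
  §10.2.2.
* [Griffiths1969] P. Griffiths, On the periods of certain rational integrals I, Ann. of Math. 90 (1969), §8.
-/

noncomputable section

open scoped Manifold ContDiff Topology TensorProduct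
open CategoryTheory AlgebraicGeometry Set Function Projectivization Complex
open Literature.NumberTheory.Transcendental Literature.Geometry.Kaehler Literature.AlgebraicGeometry.Motives
open Literature.AlgebraicTopology.SingularHomology
open Literature.AlgebraicGeometry.Motives.UniversalHypersurface
open Literature.AlgebraicGeometry.HodgeTheory.UniversalHypersurface

namespace Literature.AlgebraicGeometry.HodgeTheory

set_option backward.isDefEq.respectTransparency false

section Basis

variable {n : ℕ} {X : Motives.SchemeOver ℂ} {F : MvPolynomial (Fin (n + 2)) ℂ} {d : ℕ}

/-- **The Fⁿ-frame by residues of a given basis of `S^{d−n−2}`.** For `X` smooth projective of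
dimension `n ≥ 1`, `ψ = hypersurfacePoint ι` an embedding onto `V(F)`, `F` nonsingular of degree
`d ≥ n + 2`, `ψ ∘ φ_B` holomorphic in affine coordinates on the algebraic-chart model `B`, and a BASIS
`b` of the homogeneous polynomials of degree `d − n − 2`: for every family `α_j` of holomorphic-in-charts
witnesses of the residue forms `ψ_B^* Res(b_j Ω/F)`, the classes `Θ_B⁻¹((∫⊗ℂ)[α_j])` are linearly
independent and span `FⁿHⁿ` of every Hodge-symmetric model of `X`. (Proof of
`residueFrame_of_hypersurfacePoint`, with the basis as a parameter.)
[cite: VoisinHodgeII2003, §6.1.3 Cor. 6.12 (p = 1)] [cite: VoisinHodgeI2002, §7.1.1 Cor. 7.6] -/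
theorem residueFrame_of_hypersurfacePoint_basis (hn : 1 ≤ n) (hd : n + 2 ≤ d) (hF : F.IsHomogeneous d)
    (ι : X ⟶ projectiveSpace (n + 1) ℂ) (hemb : Topology.IsEmbedding (hypersurfacePoint ι))
    (hrange : Set.range (hypersurfacePoint ι) = projZeroLocus {F})
    (hJ : SmoothHypersurface.IsNonsingularForm ℂ F) (hX : IsSmoothProjective n X)
    (hhol : HasHolomorphicCoords (algebraicModel hX).model
      (hypersurfacePoint ι ∘ (algebraicModel hX).toComplexPoints))
    {J : Type} [Fintype J]
    (b : Module.Basis J ℂ ↥(MvPolynomial.homogeneousSubmodule (Fin (n + 2)) ℂ (d - (n + 2))))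
    (α : J → holFormsInCharts (algebraicModel hX).model (algebraicModel hX).carrier n)
    (hα : ∀ j, (α j : MForm 𝓘(ℝ, (algebraicModel hX).model) (algebraicModel hX).carrier ℂ n) =
      residueForm (E := (algebraicModel hX).model)
        (hypersurfacePoint ι ∘ (algebraicModel hX).toComplexPoints) F (b j : MvPolynomial (Fin (n + 2)) ℂ)) :
    LinearIndependent ℂ (fun j ↦ ((algebraicModel hX).complexification hX n).symm
        (complexifyFun (integrationDeRhamIsoFamily (algebraicModel hX).model) n
          (complexDeRhamCohomology.mk _ _ n
            (holFormsInChartsToClosed (algebraicModel hX).finrank_model (α j))))) ∧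
      ∀ (A : HodgeModel n X) (hA : A.IsHodgeSymmetric),
        (A.hodgeStructure hX hA n).F n =
          Submodule.span ℂ (Set.range fun j ↦ ((algebraicModel hX).complexification hX n).symm
            (complexifyFun (integrationDeRhamIsoFamily (algebraicModel hX).model) n
              (complexDeRhamCohomology.mk _ _ n
                (holFormsInChartsToClosed (algebraicModel hX).finrank_model (α j))))) := by
  classical
  obtain ⟨res, hclass, hpiece, hinj⟩ := exists_residueClassMap hn hd hF ι hemb hrange hJ hX _ hhol
  haveI : Module.Finite ℚ ↥(singularCohomology ℚ ℚ (ComplexPoints X) n) := BettiUniverse.finite hX n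
  haveI : Module.Finite ℂ ↥(MvPolynomial.homogeneousSubmodule (Fin (n + 2)) ℂ (d - (n + 2))) :=
    Module.Finite.iff_fg.mpr (MvPolynomial.homogeneousSubmodule_fg (Fin (n + 2)) ℂ _)
  have hbP : ∀ j, ((b j : ↥(MvPolynomial.homogeneousSubmodule (Fin (n + 2)) ℂ (d - (n + 2)))) : MvPolynomial (Fin (n + 2)) ℂ).IsHomogeneous (d - (n + 2)) := fun j ↦
    (MvPolynomial.mem_homogeneousSubmodule _ _).mp (b j).2
  -- the explicit classes ARE `res (b j)`
  have hx : ∀ j, ((algebraicModel hX).complexification hX n).symm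
      (complexifyFun (integrationDeRhamIsoFamily (algebraicModel hX).model) n
        (complexDeRhamCohomology.mk _ _ n (holFormsInChartsToClosed (algebraicModel hX).finrank_model (α j)))) =
      res (b j : MvPolynomial (Fin (n + 2)) ℂ) := by
    intro j
    rw [LinearEquiv.symm_apply_eq, hclass _ (hbP j) (α j) (hα j), HodgeModel.topHolFormClass_apply]
    rfl
  simp_rw [hx]
  -- `res` is injective on `S^k`
  have hker : LinearMap.ker (res.domRestrict (MvPolynomial.homogeneousSubmodule (Fin (n + 2)) ℂ (d - (n + 2)))) = ⊥ := by
    refine eq_bot_iff.mpr fun P hP ↦ ?_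
    rw [LinearMap.mem_ker, LinearMap.domRestrict_apply] at hP
    rw [Submodule.mem_bot]
    exact Subtype.ext (hinj _ ((MvPolynomial.mem_homogeneousSubmodule _ _).mp P.2) hP)
  have hli : LinearIndependent ℂ (fun j ↦ res (b j : MvPolynomial (Fin (n + 2)) ℂ)) :=
    b.linearIndependent.map' _ hker
  refine ⟨hli, fun A hA ↦ ?_⟩
  rw [hodgeStructure_F_eq_of_isHodgeSymmetric hX A (algebraicModel hX) hA (algebraicModel_isHodgeSymmetric hX)]
  have hle : Submodule.span ℂ (Set.range fun j ↦ res (b j : MvPolynomial (Fin (n + 2)) ℂ)) ≤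
      ((algebraicModel hX).hodgeStructure hX (algebraicModel_isHodgeSymmetric hX) n).F n := by
    rw [hodgeStructure_F_self_eq_ratPiece hX (algebraicModel hX) (algebraicModel_isHodgeSymmetric hX),
      Submodule.span_le]
    rintro _ ⟨j, rfl⟩
    exact hpiece _
  refine (Submodule.eq_of_le_of_finrank_eq hle ?_).symm
  rw [finrank_span_eq_card hli, ← Module.finrank_eq_card_basis b,
    finrank_hodgeStructure_F_self_eq_choose hn hd hF ι hemb hrange hJ hX (algebraicModel hX)
      (algebraicModel_isHodgeSymmetric hX) hhol, finrank_homogeneousSubmodule_sub_eq_choose hd]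

end Basis

section Family

variable (n₀ d : ℕ) {σ : Type} (sp : CoeffRing ℂ (n₀ + 1) d →ₐ[ℂ] MvPolynomial σ ℂ)

/-- **The relative residue forms restrict to a frame of `FⁿHⁿ` on every nearby fibre** (see the
module docstring): for `f = familySpz ℂ (n₀+1) d sp`, `d ≥ n₀ + 3`, a base smooth of relative dimension
`m` and `t₁ ∈ S_sp(ℂ)`, a number `r` (`= C(d−1, n₀+2)`) and smooth `(n₀+1)`-forms
`Ξ_j` on `𝒴_sp(ℂ)` (algebraic charts) and an open `W ∋ t₁`, with the vertical `(1,0)`-condition over `W`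
(kernel form), such that for every `b ∈ W`, on the algebraic-chart model of the fibre `X_b`: closed forms `β_j = (X_b ↪ 𝒴_sp)^*Ξ_j`
and rational-side classes `x_j` with `Θ (x_j) = (∫⊗ℂ)[β_j]`, linearly independent and spanning `FⁿHⁿ(X_b)`
of every Hodge-symmetric model. [cite: Griffiths1969, §8] [cite: VoisinHodgeII2003, §6.1.3 Cor. 6.12 and §6.2.1]
[cite: VoisinHodgeI2002, §10.2.2] -/
theorem exists_residueFrame_familySpz [Finite σ] {m : ℕ}
    [AlgebraicGeometry.SmoothOfRelativeDimension m (baseSpz ℂ (n₀ + 1) d sp).hom]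
    (hf : IsSmoothProjectiveFamily (familySpz ℂ (n₀ + 1) d sp) (n₀ + 1)) (hd : n₀ + 1 + 2 ≤ d)
    (t₁ : ComplexPoints (baseSpz ℂ (n₀ + 1) d sp)) :
    letI := smoothOfRelativeDimension_total (m := m) (familySpz ℂ (n₀ + 1) d sp) hf
    letI : Smooth (totalSpz ℂ (n₀ + 1) d sp).hom := SmoothOfRelativeDimension.smooth (n₀ + 1 + m) _
    letI : LocallyOfFiniteType (totalSpz ℂ (n₀ + 1) d sp).hom := inferInstance
    letI : Smooth (baseSpz ℂ (n₀ + 1) d sp).hom := SmoothOfRelativeDimension.smooth m _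
    letI : LocallyOfFiniteType (baseSpz ℂ (n₀ + 1) d sp).hom := inferInstance
    letI := chartedSpaceOfCharts (ComplexPoints.algebraicChart (totalSpz ℂ (n₀ + 1) d sp) (n₀ + 1 + m))
      (ComplexPoints.mem_algebraicChart_source (totalSpz ℂ (n₀ + 1) d sp) (n₀ + 1 + m))
    letI := chartedSpaceOfCharts (ComplexPoints.algebraicChart (baseSpz ℂ (n₀ + 1) d sp) m)
      (ComplexPoints.mem_algebraicChart_source (baseSpz ℂ (n₀ + 1) d sp) m)
    letI : ∀ b : ComplexPoints (baseSpz ℂ (n₀ + 1) d sp),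
        ChartedSpace (Fin (n₀ + 1) → ℂ) (ComplexPoints (fiberOver (familySpz ℂ (n₀ + 1) d sp) b)) :=
      fun b ↦ (algebraicModel (hf.isSmoothProjective b)).chartedSpace
    ∃ (r : ℕ) (Ξ : Fin r →
        MForm 𝓘(ℝ, Fin (n₀ + 1 + m) → ℂ) (ComplexPoints (totalSpz ℂ (n₀ + 1) d sp)) ℂ (n₀ + 1))
      (W : Set (ComplexPoints (baseSpz ℂ (n₀ + 1) d sp))), IsOpen W ∧ t₁ ∈ W ∧
      r = Nat.choose (d - 1) (n₀ + 1 + 1) ∧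
      (∀ j, IsSmoothForm (Ξ j)) ∧
      (∀ j (y : ComplexPoints (totalSpz ℂ (n₀ + 1) d sp)),
        AlgPoints.map (familySpz ℂ (n₀ + 1) d sp) y ∈ W →
        ∀ (v : Fin (n₀ + 1 + m) → ℂ) (w : Fin (n₀ + 1) → (Fin (n₀ + 1 + m) → ℂ)),
        (∀ i, mfderiv 𝓘(ℝ, Fin (n₀ + 1 + m) → ℂ) 𝓘(ℝ, Fin m → ℂ)
          (AlgPoints.map (familySpz ℂ (n₀ + 1) d sp)) y (w i) = 0) →
        (show (Fin (n₀ + 1 + m) → ℂ) [⋀^Fin (n₀ + 1 + 1)]→L[ℝ] ℂ from mextDeriv (Ξ j) y)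
            (Fin.cons (I • v) w) =
          I * (show (Fin (n₀ + 1 + m) → ℂ) [⋀^Fin (n₀ + 1 + 1)]→L[ℝ] ℂ from mextDeriv (Ξ j) y)
            (Fin.cons v w)) ∧
      ∀ b ∈ W,
        ∃ (x : Fin r → ℂ ⊗[ℚ] singularCohomology ℚ ℚ
            (ComplexPoints (fiberOver (familySpz ℂ (n₀ + 1) d sp) b)) (n₀ + 1))
          (β : Fin r → cclosedSmoothForms (algebraicModel (hf.isSmoothProjective b)).model
            (algebraicModel (hf.isSmoothProjective b)).carrier (n₀ + 1)),
        (∀ j, (β j : MForm 𝓘(ℝ, (algebraicModel (hf.isSmoothProjective b)).model)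
            (algebraicModel (hf.isSmoothProjective b)).carrier ℂ (n₀ + 1)) =
          (Ξ j).pullback 𝓘(ℝ, (algebraicModel (hf.isSmoothProjective b)).model)
            (fun a : (algebraicModel (hf.isSmoothProjective b)).carrier ↦
              AlgPoints.map (fiberι (familySpz ℂ (n₀ + 1) d sp) b) a)) ∧
        (∀ j, (algebraicModel (hf.isSmoothProjective b)).complexification (hf.isSmoothProjective b) (n₀ + 1)
            (x j) =
          complexifyFun (integrationDeRhamIsoFamily (algebraicModel (hf.isSmoothProjective b)).model) (n₀ + 1)
            (complexDeRhamCohomology.mk _ _ (n₀ + 1) (β j))) ∧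
        LinearIndependent ℂ x ∧
        ∀ (A : HodgeModel (n₀ + 1) (fiberOver (familySpz ℂ (n₀ + 1) d sp) b)) (hA : A.IsHodgeSymmetric),
          (A.hodgeStructure (hf.isSmoothProjective b) hA (n₀ + 1)).F (n₀ + 1) =
            Submodule.span ℂ (Set.range x) := by
  classical
  set f := familySpz ℂ (n₀ + 1) d sp with hfdef
  haveI := smoothOfRelativeDimension_total (m := m) f hf
  haveI : Smooth (totalSpz ℂ (n₀ + 1) d sp).hom := SmoothOfRelativeDimension.smooth (n₀ + 1 + m) _
  haveI : LocallyOfFiniteType (totalSpz ℂ (n₀ + 1) d sp).hom := inferInstance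
  haveI : Smooth (baseSpz ℂ (n₀ + 1) d sp).hom := SmoothOfRelativeDimension.smooth m _
  haveI : LocallyOfFiniteType (baseSpz ℂ (n₀ + 1) d sp).hom := inferInstance
  letI csT := chartedSpaceOfCharts (ComplexPoints.algebraicChart (totalSpz ℂ (n₀ + 1) d sp) (n₀ + 1 + m))
    (ComplexPoints.mem_algebraicChart_source (totalSpz ℂ (n₀ + 1) d sp) (n₀ + 1 + m))
  letI csB := chartedSpaceOfCharts (ComplexPoints.algebraicChart (baseSpz ℂ (n₀ + 1) d sp) m)
    (ComplexPoints.mem_algebraicChart_source (baseSpz ℂ (n₀ + 1) d sp) m)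
  letI csX : ∀ b : ComplexPoints (baseSpz ℂ (n₀ + 1) d sp),
      ChartedSpace (Fin (n₀ + 1) → ℂ) (ComplexPoints (fiberOver f b)) :=
    fun b ↦ (algebraicModel (hf.isSmoothProjective b)).chartedSpace
  have hd1 : 1 ≤ d := by omega
  -- a basis of `S^{d-n-2}` and its glued relative residue forms
  set Sk := MvPolynomial.homogeneousSubmodule (Fin (n₀ + 1 + 2)) ℂ (d - (n₀ + 1 + 2)) with hSk
  haveI : Module.Finite ℂ ↥Sk :=
    Module.Finite.iff_fg.mpr (MvPolynomial.homogeneousSubmodule_fg (Fin (n₀ + 1 + 2)) ℂ _)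
  set r := Module.finrank ℂ ↥Sk with hr
  let bS : Module.Basis (Fin r) ℂ ↥Sk := Module.finBasis ℂ ↥Sk
  have hbP : ∀ j, ((bS j : ↥Sk) : MvPolynomial (Fin (n₀ + 1 + 2)) ℂ).IsHomogeneous (d - (n₀ + 1 + 2)) :=
    fun j ↦ (MvPolynomial.mem_homogeneousSubmodule _ _).mp (bS j).2
  obtain ⟨O, hOo, ht₁O, hrel⟩ := exists_relativeResidueForms_familySpz_of_isHomogeneous n₀ d sp hd m hf t₁
  choose Ξ hΞs hΞι hΞhol hdΞ using fun j : Fin r ↦ hrel _ (hbP j)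
  refine ⟨r, Ξ, O, hOo, ht₁O, finrank_homogeneousSubmodule_sub_eq_choose hd, hΞs, hdΞ, fun b hb ↦ ?_⟩
  -- the fibre over `b ∈ O`
  haveI := (hf.isSmoothProjective b).smoothOfRelativeDimension
  haveI : Smooth (fiberOver f b).hom := SmoothOfRelativeDimension.smooth (n₀ + 1) _
  haveI : LocallyOfFiniteType (fiberOver f b).hom := inferInstance
  have hholb : HasHolomorphicCoords (algebraicModel (hf.isSmoothProjective b)).model
      (hypersurfacePoint (fiberι f b ≫ totalSpzToTotal ℂ (n₀ + 1) d sp ≫ toProjectiveSpace ℂ (n₀ + 1) d) ∘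
        (algebraicModel (hf.isSmoothProjective b)).toComplexPoints) :=
    hasHolomorphicCoords_hypersurfacePoint_comp _ (algebraicModel (hf.isSmoothProjective b)).isAnalytification
  -- the pull-backs `(X_b ↪ 𝒴_sp)^* Ξ_j`, read on the algebraic-chart model of `X_b`
  have hpb : ∀ j, (Ξ j).pullback 𝓘(ℝ, (algebraicModel (hf.isSmoothProjective b)).model)
      (fun a : (algebraicModel (hf.isSmoothProjective b)).carrier ↦ AlgPoints.map (fiberι f b) a) =
      residueForm (E := Fin (n₀ + 1) → ℂ)
        (hypersurfacePoint (fiberι f b ≫ totalSpzToTotal ℂ (n₀ + 1) d sp ≫ toProjectiveSpace ℂ (n₀ + 1) d))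
        (pointFormSpz ℂ (n₀ + 1) d sp b) (bS j : MvPolynomial (Fin (n₀ + 1 + 2)) ℂ) :=
    fun j ↦ hΞι j b hb
  let α : Fin r → holFormsInCharts (algebraicModel (hf.isSmoothProjective b)).model
      (algebraicModel (hf.isSmoothProjective b)).carrier (n₀ + 1) := fun j ↦
    ⟨(Ξ j).pullback 𝓘(ℝ, (algebraicModel (hf.isSmoothProjective b)).model)
      (fun a : (algebraicModel (hf.isSmoothProjective b)).carrier ↦ AlgPoints.map (fiberι f b) a), by
      rw [mem_holFormsInCharts_iff, hpb j]
      exact (hΞhol j b hb).1⟩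
  have hα : ∀ j, (α j : MForm 𝓘(ℝ, (algebraicModel (hf.isSmoothProjective b)).model)
      (algebraicModel (hf.isSmoothProjective b)).carrier ℂ (n₀ + 1)) =
      residueForm (E := (algebraicModel (hf.isSmoothProjective b)).model)
        (hypersurfacePoint (fiberι f b ≫ totalSpzToTotal ℂ (n₀ + 1) d sp ≫ toProjectiveSpace ℂ (n₀ + 1) d) ∘
          (algebraicModel (hf.isSmoothProjective b)).toComplexPoints)
        (pointFormSpz ℂ (n₀ + 1) d sp b) (bS j : MvPolynomial (Fin (n₀ + 1 + 2)) ℂ) :=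
    fun j ↦ hpb j
  obtain ⟨hli, hspan⟩ := residueFrame_of_hypersurfacePoint_basis (Nat.le_add_left 1 n₀) hd
    (isHomogeneous_pointForm ℂ (n₀ + 1) d _) _ (isEmbedding_hypersurfacePoint_fiberι_totalSpz (n₀ + 1) d sp b)
    (range_hypersurfacePoint_fiberι_totalSpz (n₀ + 1) d sp hd1 b) (isNonsingularForm_pointForm ℂ (n₀ + 1) d _)
    (hf.isSmoothProjective b) hholb bS α hα
  refine ⟨fun j ↦ ((algebraicModel (hf.isSmoothProjective b)).complexification (hf.isSmoothProjective b)
      (n₀ + 1)).symm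
      (complexifyFun (integrationDeRhamIsoFamily (algebraicModel (hf.isSmoothProjective b)).model) (n₀ + 1)
        (complexDeRhamCohomology.mk _ _ (n₀ + 1)
          (holFormsInChartsToClosed (algebraicModel (hf.isSmoothProjective b)).finrank_model (α j)))),
    fun j ↦ holFormsInChartsToClosed (algebraicModel (hf.isSmoothProjective b)).finrank_model (α j),
    fun j ↦ rfl, fun j ↦ ?_, hli, hspan⟩
  rw [LinearEquiv.apply_symm_apply]

end Family

end Literature.AlgebraicGeometry.HodgeTheory

end
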